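import Summits.BirchSwinnertonDyer.BirchSwinnertonDyer.Theorems.RamifiedHeegnerPairRamifiedPairUpperBoundRankOneMember
import HarnessLib

/-!
# Route `RamifiedHeegnerPair`, crux X2 `RamifiedPairUpperBound` (stmt-BirchSwinnertonDyer-23192) — X2's MARGINAL
# content INSIDE the route: given the other binders of `closes` (GZK, twist supply, the residual, and X1), a
# rank-one pair needs ONLY the split-field Kolyvagin socket at one Heegner datum

HONEST FRAMING. Theorems only; helper file (`--supports stmt-BirchSwinnertonDyer-23192 --as helper`); nothing is
booked, no item is closed, BSD is not proved for any curve; CONDITIONAL on every displayed input, in particular on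
the route's OTHER open items taken as hypotheses (X1 `RamifiedPairLowerBound`, the residual
`GoodSupersingularAtThree`) — this file measures what X2 adds to them, it does not advance them.

* `leafMissingLowerBoundAt_of_pairLower_of_supply_of_residual` — the mirror of the deciding theorem's bookkeeping:
  `PublishedInputGZK → PublishedInputTwists → RamifiedTwistSupplyOfPub → GoodSupersingularAtThree →
  RamifiedPairLowerBound →` every non-CM Gss2-at-3 curve of analytic rank `≤ 1` has the LOWER half
  `Typed.MissingLowerBoundAt W 3` (the supply gives a 3-ramified good-ss partner, the residual pays its exact
  `BSD₃`, X1 isolates the leaf member). In particular the rank-ZERO Gss2 twist `Wd` in skeleton v4's road for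
  `stub_leafRankOneUpper` gets its lower half from X1 — no new item.
* `jointUpperBoundAt_rankOne_of_socket_inside_route` — X2's conclusion at a rank-one pair `(W, V, d)` from the
  route's binders `hP hT hSR hR`, X1 `hL`, the printed facts, and ONE split Heegner datum of `W` carrying the
  Kolyvagin-side socket `IndexUpperBoundLeAt W 3 K′ P (v₃ c)`: the partner's half is the residual's
  (the residual's `BSD₃(V)`, no `surj(9)`), the twist's lower half is X1's (above), the member's
  upper half is p606327 §2. So, INSIDE the route, X2 on the rank-one pairs = «the socket» = Tamagawa-exact Kolyvagin
  at an additive `3` over a split field (print on tam-free rows, `RKC3Divisibility`-shape otherwise); on the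
  rank-zero pairs X2 = `stub_leafRankZeroUpper` + the residual (`jointUpperBoundAt_rankZero_inside_route`).

Lead prover bsd-line-rhp-p2 g2, 2026-08-28. References: [cite: GrossZagier1986, Thm. I.(6.3), I.(7.3)]
[cite: JetchevSkinnerWan2017, §7.4.1] [cite: Miller2011LMS, §1 and Def. 1.1].
-/

-- D-0017: single-problem summit, so `Summit.BirchSwinnertonDyer.BirchSwinnertonDyer.…` repeats a namespace BY DESIGN.
set_option linter.dupNamespace false
set_option autoImplicit false

noncomputable section

open scoped Classical

open WeierstrassCurve NumberField Literature.NumberTheory.EllipticCurves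
  Literature.NumberTheory.EllipticCurves.ModularForms Literature.NumberTheory.EllipticCurves.Rank1Residual
  Literature.NumberTheory.EllipticCurves.Rank1Residual.Typed
  Summit.BirchSwinnertonDyer.Rank1Residual.Additive
  Summit.BirchSwinnertonDyer.BirchSwinnertonDyer.Theses.RamifiedHeegnerPair
  Summit.BirchSwinnertonDyer.BirchSwinnertonDyer.Theorems.SchneiderFree

namespace Summit.BirchSwinnertonDyer.BirchSwinnertonDyer.Theorems.RamifiedPairUpperBound

/-- **Every leaf member's LOWER half from the route's other binders.** `PublishedInputGZK` (for `Ш(V)` finite),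
`PublishedInputTwists` + `RamifiedTwistSupplyOfPub` (a 3-ramified good-supersingular partner `V` of complementary
analytic rank), `GoodSupersingularAtThree` (the residual: `BSD₃(V)` exactly) and X1 `RamifiedPairLowerBound` give
`Typed.MissingLowerBoundAt W 3` for every non-CM globally minimal `W` of class `(G) ∧ ss` additive at `3` with
`r_an(W) ≤ 1` — the same bookkeeping as the route's `closes`, stopped one step earlier. CONDITIONAL on the route's
open items `hR`, `hL`. [cite: Miller2011LMS, §1 and Def. 1.1 (arXiv:1010.2431 p. 3)] -/
theorem leafMissingLowerBoundAt_of_pairLower_of_supply_of_residual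
    (hP : PublishedInputGZK) (hT : PublishedInputTwists) (hSR : RamifiedTwistSupplyOfPub)
    (hR : GoodSupersingularAtThree) (hL : RamifiedPairLowerBound)
    (W : WeierstrassCurve ℚ) [W.IsElliptic] [W.IsGloballyMinimal]
    (hCM : ¬ W.HasCM) (hadd : Addv W 3) (hsub : SubGss W 3) (hr : W.analyticRank ≤ 1) :
    MissingLowerBoundAt W 3 := by
  obtain ⟨d, V, _, _, hd, hv, hsq, hC, hCMV, hss, hsum⟩ := hSR hT W hCM hadd hsub hr
  have hrV : V.analyticRank ≤ 1 := by omega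
  have hBV : BSDp V 3 := hR V hCMV hss hrV
  haveI : Finite V.sha := (hP V hrV).2
  obtain ⟨q'', hq'', hv''⟩ := missingPPartAt_of_bsdp V 3 hBV
  obtain ⟨q, q', hq, hq', hle⟩ := hL W V d hCM hadd hsub hd hv hsq hC hss hsum
  have e1 : q'' = q' := by exact_mod_cast hq''.symm.trans hq'
  subst e1
  exact ⟨q, hq, by linarith⟩

/-- **X2 at a rank-ONE pair INSIDE the route = the split-field socket at one datum.** Binders of `closes`
(`hP`, `hT`, `hSR`, `hR`) + X1 (`hL`) + the printed facts (`hGZ`, `hKo`, `hmod`, `hGZ73`) + for the rank-one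
member `W` (additive of class `(G) ∧ ss` at `3`, non-CM) ONE Heegner datum over a split `K′` with odd `d_{K′} < −4`,
`L(W^{(d_{K′})},1) ≠ 0`, a globally minimal NON-CM model `Wd` of the twist lying again on the leaf (`Addv Wd 3`,
`SubGss Wd 3` — hypotheses; true for every twist by a discriminant prime to `3`, not re-proved here), and the
socket `IndexUpperBoundLeAt W 3 K′ P (v₃ c)` ⟹ `JointUpperBoundAt W V 3`, X2's conclusion at `(W, V, d)`.
The partner's half is the residual's; the twist's lower half is X1's; nothing else is used.
[cite: GrossZagier1986, Thm. I.(6.3) and (7.3)] [cite: JetchevSkinnerWan2017, §7.4.1] [cite: Miller2011LMS, Def. 1.1] -/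
theorem jointUpperBoundAt_rankOne_of_socket_inside_route
    (hGZ : ∀ (N : ℕ) [NeZero N] (W : WeierstrassCurve ℚ) (K : Type) [Field K] [NumberField K],
      gross_zagier N W K)
    (hKo : ∀ (N : ℕ) [NeZero N] (W : WeierstrassCurve ℚ) (K : Type) [Field K] [NumberField K],
      kolyvagin N W K)
    (hmod : hasEntireLFunction_rat) (hGZ73 : GrossZagier1986_thm_I_7_3)
    (hP : PublishedInputGZK) (hT : PublishedInputTwists) (hSR : RamifiedTwistSupplyOfPub)
    (hR : GoodSupersingularAtThree) (hL : RamifiedPairLowerBound)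
    (W : WeierstrassCurve ℚ) [W.IsElliptic] [W.IsGloballyMinimal]
    (V : WeierstrassCurve ℚ) [V.IsElliptic] [V.IsGloballyMinimal]
    (hadd : Addv W 3) (hCMV : ¬ V.HasCM) (hss : GoodSS V 3)
    (hsum : W.analyticRank + V.analyticRank = 1) (hr : W.analyticRank = 1)
    (N : ℕ) [NeZero N] (K : Type) [Field K] [NumberField K]
    (Dt : ModularParametrizationData W N) (H : HeegnerDatum N (NumberField.discr K)) (ι : K →+* ℂ)
    (P : (W.baseChange K).toAffine.Point) (Wd : WeierstrassCurve ℚ) [Wd.IsElliptic] [Wd.IsGloballyMinimal]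
    (hN : W.conductorNorm ℤ = N) (hK : IsImaginaryQuadratic K) (hodd : Odd (NumberField.discr K))
    (hd4 : NumberField.discr K < -4) (hHH : SatisfiesHeegnerHypothesis N K)
    (hLd : (W.quadraticTwist (NumberField.discr K : ℚ)).entireLFunction 1 ≠ 0)
    (hPt : WeierstrassCurve.Affine.Point.map ι.toRatAlgHom P = heegnerPointComplex Dt H)
    (hC : ∃ C : WeierstrassCurve.VariableChange ℚ, C • W.quadraticTwist (NumberField.discr K : ℚ) = Wd)
    (hCMd : ¬ Wd.HasCM) (haddd : Addv Wd 3) (hsubd : SubGss Wd 3)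
    (hI : Upper.IndexUpperBoundLeAt W 3 K P (padicValNat 3 Dt.c.natAbs)) :
    Upper.JointUpperBoundAt W V 3 := by
  have hrV : V.analyticRank ≤ 1 := by omega
  -- the twist is rank zero: `L(Wd, 1) ≠ 0`
  have hLd1 : Wd.entireLFunction 1 ≠ 0 := by
    obtain ⟨Cd, hWd⟩ := hC
    have hD0 : (NumberField.discr K : ℚ) ≠ 0 := by exact_mod_cast NumberField.discr_ne_zero K
    haveI : (W.quadraticTwist (NumberField.discr K : ℚ)).IsElliptic := W.isElliptic_quadraticTwist hD0
    rw [← hWd, entireLFunction_smul]; exact hLd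
  have hrd : Wd.analyticRank ≤ 1 := by
    rw [(Wd.analyticRank_eq_zero_iff_holds (hmod Wd)).2 hLd1]; exact zero_le_one
  -- the twist's LOWER half from X1 + supply + residual
  have hlow : MissingLowerBoundAt Wd 3 :=
    leafMissingLowerBoundAt_of_pairLower_of_supply_of_residual hP hT hSR hR hL Wd hCMd haddd hsubd hrd
  -- the member's UPPER half from the socket (p606327 §2)
  have hUW : MissingUpperBoundAt W 3 :=
    missingUpperBoundAt_three_of_rankOne_addv_of_upperSocket_of_twistLower hGZ hKo hP hmod hGZ73 W hadd hr
      N K Dt H ι P Wd hN hK hodd hd4 hHH hLd hPt hC hI hlow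
  -- the partner's half is the residual's (`BSD₃(V)` exactly, `Ш(V)` finite by GZK)
  obtain ⟨q, hq, hleW⟩ := hUW
  haveI : Finite V.sha := (hP V hrV).2
  obtain ⟨q', hq', hleV⟩ :=
    (lower_and_upper_of_missingPPartAt V 3 (missingPPartAt_of_bsdp V 3 (hR V hCMV hss hrV))).2
  exact ⟨q, q', hq, hq', by linarith⟩

/-- **X2 at a rank-ZERO pair INSIDE the route = `stub_leafRankZeroUpper` at `W`.** With the residual paying the
rank-one good-supersingular partner, X2's conclusion at `(W, V, d)` with `r_an(W) = 0` is exactly the leaf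
member's `Typed.MissingUpperBoundAt W 3` (Kato-sharp rows: print, companion files). [cite: Miller2011LMS, Def. 1.1] -/
theorem jointUpperBoundAt_rankZero_inside_route
    (hP : PublishedInputGZK) (hR : GoodSupersingularAtThree)
    (W : WeierstrassCurve ℚ) [W.IsElliptic] [W.IsGloballyMinimal]
    (V : WeierstrassCurve ℚ) [V.IsElliptic] [V.IsGloballyMinimal]
    (hCMV : ¬ V.HasCM) (hss : GoodSS V 3) (hsum : W.analyticRank + V.analyticRank = 1)
    (hUW : MissingUpperBoundAt W 3) :
    Upper.JointUpperBoundAt W V 3 := by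
  have hrV : V.analyticRank ≤ 1 := by omega
  obtain ⟨q, hq, hleW⟩ := hUW
  haveI : Finite V.sha := (hP V hrV).2
  obtain ⟨q', hq', hleV⟩ :=
    (lower_and_upper_of_missingPPartAt V 3 (missingPPartAt_of_bsdp V 3 (hR V hCMV hss hrV))).2
  exact ⟨q, q', hq, hq', by linarith⟩

end Summit.BirchSwinnertonDyer.BirchSwinnertonDyer.Theorems.RamifiedPairUpperBound

end
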